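import Mathlib
import HarnessLib

/-!
# Varah's bound `‖A⁻¹‖_∞ ≤ 1 / minᵢ (|aᵢᵢ| − Σ_{j ≠ i} |aᵢⱼ|)` for strictly diagonally dominant matrices

Topic `Literature/LinearAlgebra/Matrix`; support file (everything PROVED; no definitions; no named
facts). Sub-namespace `Varah` (it names the bound). Norm: the `ℓ∞` operator norm ("maximum row sum",
`open scoped Matrix.Norms.Operator`), as in the companions `…ResolventPerturbation`, `…BauerFike`,
`…BlockGershgorin`.

THE RESULT. Varah 1975 [Varah1975] (restated as "Theorem A" with (4.1)–(4.3) in Varga's survey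
[Varga1976MMatrixTheory, §4], which also records that the bound appears earlier in Ahlberg–Nilson 1963,
and as "Theorem 1 (see [7]) … We call the bound in Theorem 1 the Varah's bound" in [GaoLiLi2014, §1];
generalised to H-matrices in [Varga1976] / [Varga1976MMatrixTheory, Thm 2 (4.7)]): if
`A ∈ ℂ^{n×n}` is strictly diagonally dominant by rows and `α := minᵢ (|aᵢᵢ| − Σ_{j ≠ i} |aᵢⱼ|)`, then
`‖A⁻¹‖_∞ ≤ 1/α`.

* THE LOWER BOUND (the one-line heart of the proof: pick a component of `x` of maximal modulus):
  if every row of `A` satisfies `δ + Σ_{j ≠ i} ‖aᵢⱼ‖ ≤ ‖aᵢᵢ‖`, then `δ ‖x‖_∞ ≤ ‖A x‖_∞` for every vector `x`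
  (`mul_norm_le_norm_mulVec`; any normed field, `δ` of either sign, no invertibility needed).
* MARGIN FORM: with a uniform margin `0 < δ`, `A` is invertible and `‖A⁻¹‖_∞ ≤ δ⁻¹`
  (`isUnit_det_of_margin`, `linfty_norm_inv_le_of_margin`) — the form a verifier uses (it checks
  `δ ≤ |aᵢᵢ| − Σ_{j ≠ i} |aᵢⱼ|` row by row in rational / interval arithmetic and never inverts `A`).
* LITERAL FORM with the minimum over the (nonempty) index set (`linfty_norm_inv_le_inv_inf_gap`).
* VECTOR / RESIDUAL FORMS: `‖x‖_∞ ≤ δ⁻¹ ‖A x‖_∞` (`norm_le_inv_mul_norm_mulVec`) and the a-posteriori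
  error bound `‖x − x̃‖_∞ ≤ δ⁻¹ ‖b − A x̃‖_∞` for `A x = b` (`norm_sub_le_inv_mul_norm_residual`).

Invertibility itself is Mathlib's Levy–Desplanques theorem `Matrix.det_ne_zero_of_sum_row_lt_diag`
([HornJohnson2013, Cor. 5.6.17, Thm 6.1.10 (a)]); the NORM BOUND is the content of this file.

RELATION TO THE TREE (dedup). Not a restatement of anything landed: the nearest results are
`Literature.LinearAlgebra.Matrix.Resolvent.linfty_norm_inv_sub_le` (`…ResolventPerturbation`: the
Neumann-series bound `‖(U − E)⁻¹‖ ≤ ‖U⁻¹‖ / (1 − ‖U⁻¹E‖)`, which with `U = diag A` yields only the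
WEAKER constant `maxᵢ |aᵢᵢ|⁻¹ / (1 − maxᵢ rᵢ/|aᵢᵢ|) ≥ 1/minᵢ (|aᵢᵢ| − rᵢ)`),
`Literature.Analysis.ValidatedNumerics.abs_le_div_of_eq_add_mulVec` (`…IntervalLinearSystems`: the
real, unit-diagonal special case `d = r + E d`, `Σⱼ |Eᵢⱼ| ≤ β < 1 ⇒ |dᵢ| ≤ R/(1 − β)`, Neumaier
Prop. 4.1.9 (7) — it follows from `mul_norm_le_norm_mulVec` with `A = 1 − E`, `δ = 1 − β`), and the
entrywise dominance of `A⁻¹` in `…DiagonallyDominantMaximalVolume` (`norm_inv_apply_le_of_rowStrictDiagDominant`,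
a different statement).

NOT TYPED here: Varah's companion bound `σ_min(A) ≥ √(α β)` when `A` and `Aᵀ` are both strictly
diagonally dominant ([Varga1976MMatrixTheory, §4 Thm B (4.4)]); Varga's H-matrix generalisation
`sup_{B ∈ Ω_A} ‖B⁻¹‖_∞ = ‖𝓜(A)⁻¹‖_∞` (ibid. Thm 2 (4.7)); the Nekrasov-matrix refinements of
[GaoLiLi2014].

References:
* J. M. Varah, *A lower bound for the smallest singular value of a matrix*, Linear Algebra Appl. 11
  (1975) 3–5. [Varah1975]
* R. S. Varga, *M-matrix theory and recent results in numerical linear algebra*, in: Sparse Matrix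
  Computations (J. R. Bunch, D. J. Rose, eds.), Academic Press, 1976, §4 "On bounding ‖A⁻¹‖_∞",
  Theorems A, B, 2, 3. [Varga1976MMatrixTheory]
* R. S. Varga, *On diagonal dominance arguments for bounding ‖A⁻¹‖_∞*, Linear Algebra Appl. 14
  (1976) 211–217. [Varga1976]
* L. Gao, C. Li, Y. Li, *A new upper bound on the infinity norm of the inverse of Nekrasov matrices*,
  J. Appl. Math. 2014, 708128, §1 Theorem 1. [GaoLiLi2014]
* R. A. Horn, C. R. Johnson, *Matrix Analysis*, 2nd ed., Cambridge 2013, Cor. 5.6.17, Thm 6.1.10.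
  [HornJohnson2013]
-/

open Matrix

namespace Literature.LinearAlgebra.Matrix.Varah

/-! ### The lower bound `δ ‖x‖_∞ ≤ ‖A x‖_∞` (any normed field) -/

section LowerBound

variable {K : Type*} [NormedField K] {n : Type*} [Fintype n]

/-- **Varah's lower bound** (the proof of Varah 1975 Thm 1): if every row of `A` has dominance
margin at least `δ`, i.e. `δ + Σ_{j ≠ i} ‖aᵢⱼ‖ ≤ ‖aᵢᵢ‖`, then `δ ‖x‖_∞ ≤ ‖A x‖_∞` for every `x`
(pick `i` with `‖xᵢ‖ = ‖x‖_∞`; then `‖(A x)ᵢ‖ ≥ ‖aᵢᵢ‖ ‖xᵢ‖ − Σ_{j ≠ i} ‖aᵢⱼ‖ ‖xⱼ‖ ≥ δ ‖x‖_∞`).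
[cite: Varah1975, proof of the bound ‖A⁻¹‖_∞ ≤ 1/α] [cite: Varga1976MMatrixTheory, §4 Thm A] -/
theorem mul_norm_le_norm_mulVec [DecidableEq n] {A : Matrix n n K} {δ : ℝ}
    (h : ∀ i, δ + ∑ j ∈ Finset.univ.erase i, ‖A i j‖ ≤ ‖A i i‖) (x : n → K) :
    δ * ‖x‖ ≤ ‖A *ᵥ x‖ := by
  rcases isEmpty_or_nonempty n with hn | hn
  · have hx : ‖x‖ = 0 := by
      rw [norm_eq_zero]; exact Subsingleton.elim _ _
    rw [hx, mul_zero]; exact norm_nonneg _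
  obtain ⟨i, -, hi⟩ :=
    Finset.exists_max_image Finset.univ (fun j => ‖x j‖) Finset.univ_nonempty
  have hxi : ‖x‖ = ‖x i‖ := by
    apply le_antisymm
    · exact (pi_norm_le_iff_of_nonneg (norm_nonneg _)).2 fun j => hi j (Finset.mem_univ j)
    · exact norm_le_pi_norm x i
  set rest : K := ∑ j ∈ Finset.univ.erase i, A i j * x j with hrest_def
  have hsplit : (A *ᵥ x) i = A i i * x i + rest := by
    rw [hrest_def, mulVec, dotProduct, ← Finset.add_sum_erase _ _ (Finset.mem_univ i)]
  have hrest : ‖rest‖ ≤ (∑ j ∈ Finset.univ.erase i, ‖A i j‖) * ‖x i‖ := by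
    calc ‖rest‖ ≤ ∑ j ∈ Finset.univ.erase i, ‖A i j * x j‖ := norm_sum_le _ _
      _ ≤ ∑ j ∈ Finset.univ.erase i, ‖A i j‖ * ‖x i‖ :=
          Finset.sum_le_sum fun j _ => by
            rw [norm_mul]
            exact mul_le_mul_of_nonneg_left (hi j (Finset.mem_univ j)) (norm_nonneg _)
      _ = (∑ j ∈ Finset.univ.erase i, ‖A i j‖) * ‖x i‖ := by rw [Finset.sum_mul]
  have hmain : ‖A i i * x i‖ ≤ ‖A i i * x i + rest‖ + ‖rest‖ := by
    calc ‖A i i * x i‖ = ‖(A i i * x i + rest) - rest‖ := by rw [add_sub_cancel_right]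
      _ ≤ ‖A i i * x i + rest‖ + ‖rest‖ := norm_sub_le _ _
  have hd : δ * ‖x i‖ ≤ (‖A i i‖ - ∑ j ∈ Finset.univ.erase i, ‖A i j‖) * ‖x i‖ :=
    mul_le_mul_of_nonneg_right (by linarith [h i]) (norm_nonneg _)
  calc δ * ‖x‖ = δ * ‖x i‖ := by rw [hxi]
    _ ≤ ‖A i i * x i‖ - (∑ j ∈ Finset.univ.erase i, ‖A i j‖) * ‖x i‖ := by
        rw [norm_mul]; linarith [hd]
    _ ≤ ‖A i i * x i + rest‖ := by linarith [hmain, hrest]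
    _ = ‖(A *ᵥ x) i‖ := by rw [hsplit]
    _ ≤ ‖A *ᵥ x‖ := norm_le_pi_norm (A *ᵥ x) i

/-- The margin hypothesis with `0 < δ` is strict diagonal dominance by rows, so `A` is invertible
(Levy–Desplanques, Mathlib `Matrix.det_ne_zero_of_sum_row_lt_diag`).
[cite: HornJohnson2013, Cor 5.6.17, Thm 6.1.10 (a)] -/
theorem isUnit_det_of_margin [DecidableEq n] {A : Matrix n n K} {δ : ℝ} (hδ : 0 < δ)
    (h : ∀ i, δ + ∑ j ∈ Finset.univ.erase i, ‖A i j‖ ≤ ‖A i i‖) : IsUnit A.det :=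
  isUnit_iff_ne_zero.2 (det_ne_zero_of_sum_row_lt_diag fun k => by linarith [h k])

/-- **Vector form**: with margin `0 < δ`, `‖x‖_∞ ≤ δ⁻¹ ‖A x‖_∞`.
[cite: Varga1976MMatrixTheory, §4 Thm A (4.3)] -/
theorem norm_le_inv_mul_norm_mulVec [DecidableEq n] {A : Matrix n n K} {δ : ℝ} (hδ : 0 < δ)
    (h : ∀ i, δ + ∑ j ∈ Finset.univ.erase i, ‖A i j‖ ≤ ‖A i i‖) (x : n → K) :
    ‖x‖ ≤ δ⁻¹ * ‖A *ᵥ x‖ := by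
  rw [le_inv_mul_iff₀ hδ]
  exact mul_norm_le_norm_mulVec h x

/-- **A-posteriori residual bound** for `A x = b` with an SDD matrix: `‖x − x̃‖_∞ ≤ δ⁻¹ ‖b − A x̃‖_∞`
(immediate from the vector form applied to `x − x̃`). [cite: Varga1976MMatrixTheory, §4 Thm A (4.3)] -/
theorem norm_sub_le_inv_mul_norm_residual [DecidableEq n] {A : Matrix n n K} {δ : ℝ} (hδ : 0 < δ)
    (h : ∀ i, δ + ∑ j ∈ Finset.univ.erase i, ‖A i j‖ ≤ ‖A i i‖) {x b : n → K} (hx : A *ᵥ x = b)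
    (y : n → K) : ‖x - y‖ ≤ δ⁻¹ * ‖b - A *ᵥ y‖ := by
  have := norm_le_inv_mul_norm_mulVec hδ h (x - y)
  rwa [mulVec_sub, hx] at this

end LowerBound

/-! ### The operator-norm statement `‖A⁻¹‖_∞ ≤ δ⁻¹` -/

section Inverse

open scoped _root_.Matrix.Norms.Operator

variable {K : Type*} [NontriviallyNormedField K] [NormedAlgebra ℝ K] {n : Type*} [Fintype n]
  [DecidableEq n]

/-- **Varah's bound, margin form**: if every row of `A` has dominance margin at least `δ > 0`,
then `A` is invertible and `‖A⁻¹‖_∞ ≤ δ⁻¹` (`ℓ∞` operator norm).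
[cite: Varah1975, the bound ‖A⁻¹‖_∞ ≤ 1/α] [cite: Varga1976MMatrixTheory, §4 Thm A (4.1)–(4.3)]
[cite: GaoLiLi2014, Thm 1] -/
theorem linfty_norm_inv_le_of_margin {A : Matrix n n K} {δ : ℝ} (hδ : 0 < δ)
    (h : ∀ i, δ + ∑ j ∈ Finset.univ.erase i, ‖A i j‖ ≤ ‖A i i‖) :
    IsUnit A.det ∧ ‖A⁻¹‖ ≤ δ⁻¹ := by
  have hU : IsUnit A.det := isUnit_det_of_margin hδ h
  refine ⟨hU, ?_⟩
  rw [linfty_opNorm_eq_opNorm]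
  refine ContinuousLinearMap.opNorm_le_bound _ (inv_nonneg.2 hδ.le) fun y => ?_
  have h1 := mul_norm_le_norm_mulVec h (A⁻¹ *ᵥ y)
  rw [mulVec_mulVec, mul_nonsing_inv A hU, one_mulVec] at h1
  have h2 : ‖A⁻¹ *ᵥ y‖ ≤ δ⁻¹ * ‖y‖ := by rwa [le_inv_mul_iff₀ hδ]
  simpa using h2

/-- **Varah's bound, literal form**: for a strictly (row) diagonally dominant matrix,
`‖A⁻¹‖_∞ ≤ 1 / minᵢ (‖aᵢᵢ‖ − Σ_{j ≠ i} ‖aᵢⱼ‖)` (the minimum over the nonempty index set) —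
Varga's (4.2)–(4.3) with `α` the minimum of the row gaps.
[cite: Varah1975, the bound ‖A⁻¹‖_∞ ≤ 1/α] [cite: Varga1976MMatrixTheory, §4 Thm A (4.2)–(4.3)] -/
theorem linfty_norm_inv_le_inv_inf_gap [Nonempty n] {A : Matrix n n K}
    (h : ∀ i, ∑ j ∈ Finset.univ.erase i, ‖A i j‖ < ‖A i i‖) :
    IsUnit A.det ∧
      ‖A⁻¹‖ ≤ (Finset.univ.inf' Finset.univ_nonempty
        fun i => ‖A i i‖ - ∑ j ∈ Finset.univ.erase i, ‖A i j‖)⁻¹ := by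
  set δ := Finset.univ.inf' Finset.univ_nonempty
    fun i => ‖A i i‖ - ∑ j ∈ Finset.univ.erase i, ‖A i j‖ with hδ_def
  have hδ : 0 < δ := by
    rw [hδ_def, Finset.lt_inf'_iff]
    intro i _; linarith [h i]
  have hle : ∀ i, δ + ∑ j ∈ Finset.univ.erase i, ‖A i j‖ ≤ ‖A i i‖ := by
    intro i
    have : δ ≤ ‖A i i‖ - ∑ j ∈ Finset.univ.erase i, ‖A i j‖ :=
      Finset.inf'_le _ (Finset.mem_univ i)
    linarith
  exact linfty_norm_inv_le_of_margin hδ hle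

end Inverse

end Literature.LinearAlgebra.Matrix.Varah
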